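import Summits.ResolutionOfSingularities.ResolutionOfSingularities.Theorems.FrobeniusClosingPatchingRelPerfectDepthTargetsR5H
import Summits.ResolutionOfSingularities.ResolutionOfSingularities.Theorems.FrobeniusClosingPatchingRelPerfectDepthSepPeelStep
import Literature.AlgebraicGeometry.Resolution.KollarMonomialLocalExponents
import Literature.AlgebraicGeometry.Resolution.HypersurfaceTransform
import Summits.ResolutionOfSingularities.ResolutionOfSingularities.Theorems.FrobeniusClosingPatchingRelPerfectDepthTwoSeparation
import HarnessLib

/-!
# `PatchingRelPerfect` (stmt-ResolutionOfSingularities-16161), chain W5.2 — rung R5ᴴ, N5 tools: monomials over ONE snc family,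
# the two colon laws of the PEEL, presentations and the measure

[OURS · L1 W5.2 · res-D-pv-016 AS res-L1-w52-stub-5, N5 (res-L1-w52-plan-1 NAMING G10-5 (1); OWNER res-D-pv-055, T-R5H
`…DepthTargetsR5H`).]  NOT statements of the manuscript under review; AI-written, weaker than expert review; FACT-FREE.

After N3 (CJS transport on the carrier) and N4 (END components regular) every member of the H-side game's list is a MONOMIAL
`monoOf 𝓔 e = Π_{S ∈ 𝓔} S ^ (e S)` in ONE simple-normal-crossings family `𝓔` of regular hypersurfaces of the carrier `W`.  A PEEL
blows up a member `S₀ ∈ 𝓔` (the identity); the law of `HSepSeq` replaces every member `K` by `colon K S₀`.  This module proves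
the two colon laws — `colon (monoOf 𝓔 e) S₀ = monoOf 𝓔 (peelExp S₀ e)` (the `S₀`-exponent drops by one; members avoiding `S₀`
are unchanged because the stalks are UFDs) — the weight bounds `1 ≤ w ≤ Σ_{q ∋ S₀} a_q` for the weight `w` of the peel, and the
bookkeeping of the termination measure `μ = Σ_{charged q} a_q · deg q` (`measure_peel_add`; `μ = 0 ⇒ HSepEnd`).  The loop itself
is `…DepthHSepPeel`.

* §1 local algebra in a regular local ring (UFD): `colon (m) (p) = (m)` for `p` prime not dividing `m`; §2 monomials `monoOf`
  over an snc family and their stalks off a member; §3 presentations `ofPres`, `peelExp`, `singleExp`, the PEEL LAW and the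
  weight bounds; §4 degree, measure and their bookkeeping under a peel.
[cite: Kollar2007, (3.111) Step 3] [cite: BierstoneGrigorievMilmanWlodarczyk2011, §4 Step 2b] [cite: Matsumura1987, Thm. 14.2, Thm. 20.3]
-/

-- `Summit.<Summit>.<Sub>.Theorems` with `Sub = Summit` (single-conjunct summit, D-0017)
set_option linter.dupNamespace false

noncomputable section

open CategoryTheory CategoryTheory.Limits AlgebraicGeometry TopologicalSpace IsLocalRing
open Literature.AlgebraicGeometry.Resolution Scheme.IdealSheafData

namespace Summit.ResolutionOfSingularities.ResolutionOfSingularities.Theorems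

universe u

namespace HSepPeel

open DepthTargets DepthSep
/-! ## §1 Local algebra -/

/-- In a regular local ring, **`((m) : (z_j)) = (m)` for `m` not divisible by the prime parameter `z_j`** (UFD: Euclid's
lemma). [cite: Matsumura1987, Thm. 20.3] -/
theorem colon_span_singleton_eq_self_of_not_dvd {R : Type*} [CommRing R] [IsRegularLocalRing R] {p m : R}
    (hp : Prime p) (hpm : ¬ p ∣ m) :
    Submodule.colon (Ideal.span {m}) (Ideal.span {p} : Set R) = Ideal.span {m} := by
  haveI := isDomain_of_isRegularLocalRing R
  haveI : UniqueFactorizationMonoid R := IsRegularLocalRing.uniqueFactorizationMonoid _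
  refine le_antisymm ?_ ?_
  · intro y hy
    have hyp : y * p ∈ Ideal.span {m} := by
      have := Submodule.mem_colon.mp hy p (Ideal.mem_span_singleton_self p)
      simpa [smul_eq_mul] using this
    obtain hdvd := Ideal.mem_span_singleton.mp hyp
    by_cases hm0 : m = 0
    · subst hm0
      exact absurd (dvd_zero p) hpm
    refine Ideal.mem_span_singleton.mpr
      (UniqueFactorizationMonoid.dvd_of_dvd_mul_left_of_no_prime_factors hm0 (fun d hdm hdp hd => ?_) hdvd)
    exact hpm ((hd.associated_of_dvd hp hdp).symm.dvd.trans hdm)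
  · intro y hy
    exact Submodule.mem_colon.mpr fun q _ => by
      rw [smul_eq_mul, mul_comm]; exact (Ideal.span {m}).mul_mem_left q hy

/-! ## §2 Monomials over an snc family: the two colon laws of the PEEL -/

variable {W : Scheme.{u}}

/-- The monomial with exponent function `e` over the family `𝓔`. [folklore] -/
def monoOf (𝓔 : List W.IdealSheafData) (e : W.IdealSheafData → ℕ) : W.IdealSheafData :=
  monomialIdeal (𝓔.map fun S => (S, e S))

/-- `monoOf` over a cons. [folklore] -/
theorem monoOf_cons (S : W.IdealSheafData) (𝓔 : List W.IdealSheafData) (e : W.IdealSheafData → ℕ) :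
    monoOf (S :: 𝓔) e = S ^ e S * monoOf 𝓔 e := by
  simp [monoOf, monomialIdeal_cons]

/-- `monoOf` is invariant under permutations of the family. [folklore] -/
theorem monoOf_perm {𝓔 𝓔' : List W.IdealSheafData} (h : 𝓔.Perm 𝓔') (e : W.IdealSheafData → ℕ) :
    monoOf 𝓔 e = monoOf 𝓔' e := by
  unfold monoOf monomialIdeal
  rw [List.map_map, List.map_map]
  exact (h.map _).prod_eq

/-- Changing the exponent function off the family does not change the monomial. [folklore] -/
theorem monoOf_congr {𝓔 : List W.IdealSheafData} {e e' : W.IdealSheafData → ℕ} (h : ∀ S ∈ 𝓔, e S = e' S) :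
    monoOf 𝓔 e = monoOf 𝓔 e' := by
  unfold monoOf
  congr 1
  exact List.map_congr_left fun S hS => by rw [h S hS]

/-- **Stalk of a monomial avoiding `S₀` at a point of `S₀`**: a principal ideal `(m)` with the parameter of `S₀` not dividing
`m` (snc chart: the other members are other parameters or units). [cite: BierstoneGrigorievMilmanWlodarczyk2011, Def. 3.1.1] -/
theorem exists_stalkIdeal_monoOf_eq_span_of_exp_zero [IsLocallyNoetherian W] {𝓔₀ 𝓔 : List W.IdealSheafData} (h𝓔₀ : HasSNC 𝓔₀)
    (hsub : ∀ S ∈ 𝓔, S ∈ 𝓔₀) {S₀ : W.IdealSheafData} (hS₀ : S₀ ∈ 𝓔₀) {e : W.IdealSheafData → ℕ} (he : e S₀ = 0)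
    {x : W} (hx : x ∈ S₀.support) :
    ∃ z m : W.presheaf.stalk x, stalkIdeal S₀ x = Ideal.span {z} ∧ Prime z ∧
      stalkIdeal (monoOf 𝓔 e) x = Ideal.span {m} ∧ ¬ z ∣ m := by
  obtain ⟨hreg, u, hu, ⟨ι, hι, hιD⟩, -⟩ := h𝓔₀ x
  haveI := hreg
  haveI := isDomain_of_isRegularLocalRing (W.presheaf.stalk x)
  have hrsop : IsRsopPart (u ∘ id) := isRsopPart_comp_of_rsop rfl u hu id Function.injective_id
  set j₀ := ι ⟨S₀, hS₀, hx⟩ with hj₀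
  refine ⟨u j₀, ?_⟩
  have hz : stalkIdeal S₀ x = Ideal.span {u j₀} := hιD ⟨S₀, hS₀, hx⟩
  have hzp : Prime (u j₀) := hrsop.prime j₀
  -- induct over the family
  suffices h : ∀ 𝓔 : List W.IdealSheafData, (∀ S ∈ 𝓔, S ∈ 𝓔₀) →
      ∃ m : W.presheaf.stalk x, stalkIdeal (monoOf 𝓔 e) x = Ideal.span {m} ∧ ¬ u j₀ ∣ m by
    obtain ⟨m, hm, hndvd⟩ := h 𝓔 hsub
    exact ⟨m, hz, hzp, hm, hndvd⟩
  intro 𝓔 hsub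
  induction 𝓔 with
  | nil =>
    refine ⟨1, ?_, fun h => hzp.not_unit (isUnit_of_dvd_one h)⟩
    simp [monoOf, monomialIdeal_nil, stalkIdeal_top, Ideal.span_singleton_one]
  | cons S 𝓔 ih =>
    obtain ⟨m, hm, hndvd⟩ := ih fun T hT => hsub T (List.mem_cons_of_mem _ hT)
    have hS : S ∈ 𝓔₀ := hsub S List.mem_cons_self
    -- the stalk of `S` at `x`: a parameter `≠ u j₀` (if `x ∈ S`, `S ≠ S₀`), a unit ideal (if `x ∉ S`), or exponent `0` (`S = S₀`)
    by_cases hxS : x ∈ S.support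
    · by_cases hSS : S = S₀
      · subst hSS
        refine ⟨m, ?_, hndvd⟩
        rw [monoOf_cons, stalkIdeal_mul, stalkIdeal_pow, he, pow_zero, one_mul, hm]
      · set j := ι ⟨S, hS, hxS⟩ with hj
        have hjj : j ≠ j₀ := fun h => hSS (by
          have := hι (show ι ⟨S, hS, hxS⟩ = ι ⟨S₀, hS₀, hx⟩ from h)
          exact congrArg Subtype.val this)
        refine ⟨u j ^ e S * m, ?_, ?_⟩
        · rw [monoOf_cons, stalkIdeal_mul, stalkIdeal_pow, hιD ⟨S, hS, hxS⟩, hm, Ideal.span_singleton_pow,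
            Ideal.span_singleton_mul_span_singleton]
        · intro hdvd
          rcases hzp.dvd_or_dvd hdvd with h | h
          · exact hrsop.not_dvd hjj.symm (hzp.dvd_of_dvd_pow h)
          · exact hndvd h
    · refine ⟨m, ?_, hndvd⟩
      rw [monoOf_cons, stalkIdeal_mul, stalkIdeal_pow, stalkIdeal_eq_top_of_not_mem_support hxS, Ideal.top_pow,
        Ideal.top_mul, hm]

/-- **PEEL LAW, members avoiding `S₀`: `colon (monoOf 𝓔 e) S₀ = monoOf 𝓔 e` when `e S₀ = 0`.**
[cite: Kollar2007, (3.111) Step 3] -/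
theorem colon_monoOf_eq_self_of_exp_zero [IsLocallyNoetherian W] {𝓔₀ 𝓔 : List W.IdealSheafData} (h𝓔₀ : HasSNC 𝓔₀)
    (hsub : ∀ S ∈ 𝓔, S ∈ 𝓔₀) {S₀ : W.IdealSheafData} (hS₀ : S₀ ∈ 𝓔₀) {e : W.IdealSheafData → ℕ} (he : e S₀ = 0) :
    colon (monoOf 𝓔 e) S₀ = monoOf 𝓔 e := by
  refine le_antisymm (le_of_forall_stalkIdeal_le fun x => ?_) (le_colon_self _ _)
  rw [stalkIdeal_colon]
  by_cases hx : x ∈ S₀.support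
  · obtain ⟨z, m, hz, hzp, hm, hndvd⟩ := exists_stalkIdeal_monoOf_eq_span_of_exp_zero h𝓔₀ hsub hS₀ he hx
    haveI := (h𝓔₀ x).1
    rw [hz, hm, colon_span_singleton_eq_self_of_not_dvd hzp hndvd]
  · rw [stalkIdeal_eq_top_of_not_mem_support hx]
    intro y hy
    simpa using Submodule.mem_colon.mp hy 1 (Submodule.mem_top)

/-- **The avoiding members are NOT over `S₀`**: at a point of `S₀`, `monoOf 𝓔 e ⊄ S₀` stalkwise when `e S₀ = 0`.
[cite: BierstoneGrigorievMilmanWlodarczyk2011, §4 Step 2b] -/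
theorem not_stalkIdeal_monoOf_le_of_exp_zero [IsLocallyNoetherian W] {𝓔₀ 𝓔 : List W.IdealSheafData} (h𝓔₀ : HasSNC 𝓔₀)
    (hsub : ∀ S ∈ 𝓔, S ∈ 𝓔₀) {S₀ : W.IdealSheafData} (hS₀ : S₀ ∈ 𝓔₀) {e : W.IdealSheafData → ℕ} (he : e S₀ = 0)
    {x : W} (hx : x ∈ S₀.support) : ¬ stalkIdeal (monoOf 𝓔 e) x ≤ stalkIdeal S₀ x := by
  obtain ⟨z, m, hz, hzp, hm, hndvd⟩ := exists_stalkIdeal_monoOf_eq_span_of_exp_zero h𝓔₀ hsub hS₀ he hx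
  rw [hz, hm, Ideal.span_singleton_le_span_singleton]
  exact hndvd

/-! ## §3 Presentations and the PEEL step -/

open Classical in
/-- The exponent function after peeling `S₀`: the exponent of `S₀` drops by one (truncated). [folklore] -/
def peelExp (S₀ : W.IdealSheafData) (e : W.IdealSheafData → ℕ) : W.IdealSheafData → ℕ :=
  Function.update e S₀ (e S₀ - 1)

open Classical in
/-- The exponent function of the single member `S₀`. [folklore] -/
def singleExp (S₀ : W.IdealSheafData) : W.IdealSheafData → ℕ :=
  Function.update (fun _ => 0) S₀ 1

/-- The members of the game presented by exponent functions over `𝓔` with their charges. [folklore] -/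
def ofPres (𝓔 : List W.IdealSheafData) (P : List ((W.IdealSheafData → ℕ) × ℕ)) : List (W.IdealSheafData × ℕ) :=
  P.map fun q => (monoOf 𝓔 q.1, q.2)

/-- `peelExp` at the peeled member. [folklore] -/
theorem peelExp_self (S₀ : W.IdealSheafData) (e : W.IdealSheafData → ℕ) : peelExp S₀ e S₀ = e S₀ - 1 := by
  classical simp [peelExp]

/-- `peelExp` at the other members. [folklore] -/
theorem peelExp_of_ne {S₀ S : W.IdealSheafData} (h : S ≠ S₀) (e : W.IdealSheafData → ℕ) : peelExp S₀ e S = e S := by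
  classical simp [peelExp, h]

/-- `singleExp` at its member. [folklore] -/
theorem singleExp_self (S₀ : W.IdealSheafData) : singleExp S₀ S₀ = 1 := by
  classical simp [singleExp]

/-- `singleExp` at the other members. [folklore] -/
theorem singleExp_of_ne {S₀ S : W.IdealSheafData} (h : S ≠ S₀) : singleExp S₀ S = 0 := by
  classical simp [singleExp, h]

/-- All exponents on non-unit members zero: the unit ideal. [folklore] -/
theorem monoOf_eq_top_of_forall_eq_zero {𝓔 : List W.IdealSheafData} {e : W.IdealSheafData → ℕ}
    (h : ∀ S ∈ 𝓔, S ≠ ⊤ → e S = 0) : monoOf 𝓔 e = ⊤ := by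
  induction 𝓔 with
  | nil => simp [monoOf, monomialIdeal_nil]
  | cons S 𝓔 ih =>
    rw [monoOf_cons, ih fun T hT hTt => h T (List.mem_cons_of_mem _ hT) hTt, Scheme.IdealSheafData.mul_top]
    by_cases hSt : S = ⊤
    · rw [hSt, ← Scheme.IdealSheafData.one_eq_top, one_pow]
    · rw [h S List.mem_cons_self hSt, pow_zero, Scheme.IdealSheafData.one_eq_top]

/-- The single member `S₀` as a monomial. [folklore] -/
theorem monoOf_singleExp {𝓔 : List W.IdealSheafData} (hnd : 𝓔.Nodup) {S₀ : W.IdealSheafData} (hS₀ : S₀ ∈ 𝓔) :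
    monoOf 𝓔 (singleExp S₀) = S₀ := by
  classical
  rw [monoOf_perm (List.perm_cons_erase hS₀) _, monoOf_cons, singleExp_self, pow_one]
  have h0 : ∀ S ∈ 𝓔.erase S₀, S ≠ ⊤ → singleExp S₀ S = 0 := fun S hS _ =>
    singleExp_of_ne (fun h => (List.Nodup.not_mem_erase hnd) (h ▸ hS))
  rw [monoOf_eq_top_of_forall_eq_zero h0, Scheme.IdealSheafData.mul_top]

/-- Monomials multiply by adding exponents. [folklore] -/
theorem monoOf_add (𝓔 : List W.IdealSheafData) (e e' : W.IdealSheafData → ℕ) :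
    monoOf 𝓔 (e + e') = monoOf 𝓔 e * monoOf 𝓔 e' := by
  induction 𝓔 with
  | nil => simp [monoOf, monomialIdeal_nil]
  | cons S 𝓔 ih =>
    rw [monoOf_cons, monoOf_cons, monoOf_cons, ih, Pi.add_apply, pow_add]
    ring

/-- Powers of a single member as monomials: `monoOf 𝓔 (n • singleExp S₀) = S₀ ^ n`. [folklore] -/
theorem monoOf_nsmul_singleExp {𝓔 : List W.IdealSheafData} (hnd : 𝓔.Nodup) {S₀ : W.IdealSheafData} (hS₀ : S₀ ∈ 𝓔) (n : ℕ) :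
    monoOf 𝓔 (n • singleExp S₀) = S₀ ^ n := by
  induction n with
  | zero =>
    rw [zero_nsmul, pow_zero, Scheme.IdealSheafData.one_eq_top]
    exact monoOf_eq_top_of_forall_eq_zero fun _ _ _ => rfl
  | succ n ih => rw [succ_nsmul, monoOf_add, ih, monoOf_singleExp hnd hS₀, pow_succ]

/-- **PEEL LAW for one member**: `colon (monoOf 𝓔 e) S₀ = monoOf 𝓔 (peelExp S₀ e)` (`S₀ ∈ 𝓔` snc, no duplicates).
[cite: Kollar2007, (3.111) Step 3] -/
theorem colon_monoOf_eq_monoOf_peelExp [IsLocallyNoetherian W] {𝓔 : List W.IdealSheafData} (h𝓔 : HasSNC 𝓔) (hnd : 𝓔.Nodup)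
    {S₀ : W.IdealSheafData} (hS₀ : S₀ ∈ 𝓔) (e : W.IdealSheafData → ℕ) :
    colon (monoOf 𝓔 e) S₀ = monoOf 𝓔 (peelExp S₀ e) := by
  classical
  have hagree : ∀ S ∈ 𝓔.erase S₀, peelExp S₀ e S = e S := fun S hS =>
    peelExp_of_ne (fun h => (List.Nodup.not_mem_erase hnd) (h ▸ hS)) e
  rcases Nat.eq_zero_or_pos (e S₀) with h0 | hpos
  · -- the member avoids `S₀`: nothing happens
    have hpe : ∀ S ∈ 𝓔, peelExp S₀ e S = e S := fun S _ => by
      by_cases h : S = S₀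
      · subst h; rw [peelExp_self, h0]
      · exact peelExp_of_ne h e
    rw [monoOf_congr hpe]
    exact colon_monoOf_eq_self_of_exp_zero h𝓔 (fun _ h => h) hS₀ h0
  · -- the member contains `S₀`: one factor comes off
    obtain ⟨k, hk⟩ : ∃ k, e S₀ = k + 1 := ⟨e S₀ - 1, by omega⟩
    have hS₀c : IsEffectiveCartier S₀ := (h𝓔.hasSNCWith_of_mem hS₀).isEffectiveCartier_of_mem hS₀
    rw [monoOf_perm (List.perm_cons_erase hS₀) e, monoOf_perm (List.perm_cons_erase hS₀) (peelExp S₀ e), monoOf_cons,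
      monoOf_cons, monoOf_congr hagree, peelExp_self, hk, pow_succ', mul_assoc, colon_mul_of_isEffectiveCartier hS₀c]
    rfl

/-- Members with `S₀`-exponent `0` are not over `S₀`; hence **the weight over `S₀` is at most the total charge of the members
containing `S₀`**. [cite: BierstoneGrigorievMilmanWlodarczyk2011, §4 Step 2b] -/
theorem weightOf_ofPres_le [IsLocallyNoetherian W] {𝓔 : List W.IdealSheafData} (h𝓔 : HasSNC 𝓔) {S₀ : W.IdealSheafData}
    (hS₀ : S₀ ∈ 𝓔) (hne : (S₀.support : Set W).Nonempty) (T : Finset W.IdealSheafData)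
    (hT : ∀ K ∈ T, ∀ x ∈ (S₀.support : Set W), stalkIdeal K x ≤ stalkIdeal S₀ x) :
    ∀ P : List ((W.IdealSheafData → ℕ) × ℕ),
      weightOf (ofPres 𝓔 P) T ≤ (P.map fun q => if 1 ≤ q.1 S₀ then q.2 else 0).sum := by
  classical
  have key : ∀ e : W.IdealSheafData → ℕ, monoOf 𝓔 e ∈ T → 1 ≤ e S₀ := by
    intro e he
    by_contra h0
    have h0' : e S₀ = 0 := by omega
    obtain ⟨x, hx⟩ := hne
    exact not_stalkIdeal_monoOf_le_of_exp_zero h𝓔 (fun _ h => h) hS₀ h0' hx (hT _ he x hx)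
  intro P
  induction P with
  | nil => simp [ofPres, weightOf]
  | cons q P ih =>
    simp only [ofPres, List.map_cons, weightOf_cons, List.sum_cons] at ih ⊢
    by_cases hmem : monoOf 𝓔 q.1 ∈ T
    · rw [if_pos hmem, if_pos (key q.1 hmem)]
      exact Nat.add_le_add_left ih _
    · rw [if_neg hmem, zero_add]
      exact le_trans ih (Nat.le_add_left _ _)

/-- A member with positive `S₀`-exponent is contained in `S₀`. [folklore] -/
theorem monoOf_le_of_one_le [IsLocallyNoetherian W] {𝓔 : List W.IdealSheafData} {S₀ : W.IdealSheafData} (hS₀ : S₀ ∈ 𝓔)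
    {e : W.IdealSheafData → ℕ} (he : 1 ≤ e S₀) : monoOf 𝓔 e ≤ S₀ := by
  classical
  rw [monoOf_perm (List.perm_cons_erase hS₀) _, monoOf_cons]
  obtain ⟨k, hk⟩ : ∃ k, e S₀ = k + 1 := ⟨e S₀ - 1, by omega⟩
  rw [hk, pow_succ, mul_assoc]
  exact (DepthTwo.mul_le_left' _ _).trans (DepthTwo.mul_le_right' _ _)

/-- **The weight is at least the charge of any member over the centre.** [folklore] -/
theorem le_weightOf_ofPres {𝓔 : List W.IdealSheafData} (T : Finset W.IdealSheafData) :
    ∀ (P : List ((W.IdealSheafData → ℕ) × ℕ)) (q : (W.IdealSheafData → ℕ) × ℕ), q ∈ P → monoOf 𝓔 q.1 ∈ T →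
      q.2 ≤ weightOf (ofPres 𝓔 P) T := by
  classical
  intro P
  induction P with
  | nil => intro q hq; simp at hq
  | cons q' P ih =>
    intro q hq hT
    simp only [ofPres, List.map_cons, weightOf_cons]
    rcases List.mem_cons.mp hq with rfl | hq'
    · rw [if_pos hT]; exact Nat.le_add_right _ _
    · exact le_trans (ih q hq' hT) (Nat.le_add_left _ _)

/-! ## §4 Degree, measure, and their bookkeeping under a PEEL -/

/-- `ofPres` commutes with `map`/`append`. [folklore] -/
theorem ofPres_append (𝓔 : List W.IdealSheafData) (P Q : List ((W.IdealSheafData → ℕ) × ℕ)) :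
    ofPres 𝓔 (P ++ Q) = ofPres 𝓔 P ++ ofPres 𝓔 Q := by
  simp [ofPres]

open Classical in
/-- The degree of an exponent function: total exponent on the non-unit members. [folklore] -/
def degOf (𝓔 : List W.IdealSheafData) (e : W.IdealSheafData → ℕ) : ℕ :=
  ∑ S ∈ 𝓔.toFinset.filter (fun S => S ≠ ⊤), e S

open Classical in
/-- The termination measure `μ = Σ_{charged members} charge · degree`. [folklore] -/
def measure (𝓔 : List W.IdealSheafData) (P : List ((W.IdealSheafData → ℕ) × ℕ)) : ℕ :=
  (P.map fun q => q.2 * degOf 𝓔 q.1).sum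

/-- Peeling `S₀` lowers the degree by one exactly when the `S₀`-exponent is positive. [folklore] -/
theorem degOf_peelExp {𝓔 : List W.IdealSheafData} {S₀ : W.IdealSheafData} (hS₀ : S₀ ∈ 𝓔) (hS₀t : S₀ ≠ ⊤)
    (e : W.IdealSheafData → ℕ) :
    degOf 𝓔 e = degOf 𝓔 (peelExp S₀ e) + (if 1 ≤ e S₀ then 1 else 0) := by
  classical
  unfold degOf peelExp
  have hmem : S₀ ∈ 𝓔.toFinset.filter (fun S => S ≠ ⊤) := by simp [hS₀, hS₀t]
  rw [Finset.sum_update_of_mem hmem, ← Finset.add_sum_erase _ _ hmem, Finset.sdiff_singleton_eq_erase]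
  by_cases h : 1 ≤ e S₀
  · rw [if_pos h]; omega
  · rw [if_neg h]; omega

/-- The single member has degree one. [folklore] -/
theorem degOf_singleExp {𝓔 : List W.IdealSheafData} {S₀ : W.IdealSheafData} (hS₀ : S₀ ∈ 𝓔) (hS₀t : S₀ ≠ ⊤) :
    degOf 𝓔 (singleExp S₀) = 1 := by
  classical
  unfold degOf singleExp
  have hmem : S₀ ∈ 𝓔.toFinset.filter (fun S => S ≠ ⊤) := by simp [hS₀, hS₀t]
  rw [Finset.sum_update_of_mem hmem, Finset.sum_eq_zero (fun _ _ => rfl), add_zero]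

/-- Degree zero: the monomial is the unit ideal. [folklore] -/
theorem monoOf_eq_top_of_degOf_eq_zero {𝓔 : List W.IdealSheafData} {e : W.IdealSheafData → ℕ} (h : degOf 𝓔 e = 0) :
    monoOf 𝓔 e = ⊤ := by
  classical
  refine monoOf_eq_top_of_forall_eq_zero fun S hS hSt => (Finset.sum_eq_zero_iff.mp h) S ?_
  simp [hS, hSt]

/-- `μ = 0` is the END of the game. [folklore] -/
theorem hSepEnd_of_measure_eq_zero {𝓔 : List W.IdealSheafData} {P : List ((W.IdealSheafData → ℕ) × ℕ)}
    (h : measure 𝓔 P = 0) : HSepEnd (ofPres 𝓔 P) := by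
  intro p hp ha
  obtain ⟨q, hq, rfl⟩ := List.mem_map.mp hp
  have hz : q.2 * degOf 𝓔 q.1 = 0 :=
    List.sum_eq_zero_iff.mp h _ (List.mem_map.mpr ⟨q, hq, rfl⟩)
  have hd : degOf 𝓔 q.1 = 0 := by
    rcases Nat.mul_eq_zero.mp hz with h0 | h0
    · exact absurd h0 (by simpa using Nat.one_le_iff_ne_zero.mp ha)
    · exact h0
  exact monoOf_eq_top_of_degOf_eq_zero hd

/-- The measure of the peeled presentation: `μ(P') + (lost charge) = μ(P) + [w ≥ 2](w − 1)`-type bookkeeping, as an inequality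
`μ(P') + Σ_{e_q S₀ ≥ 1} a_q ≤ μ(P) + (w − 1)`. [folklore] -/
theorem measure_peel_add {𝓔 : List W.IdealSheafData} {S₀ : W.IdealSheafData} (hS₀ : S₀ ∈ 𝓔) (hS₀t : S₀ ≠ ⊤) (c : ℕ) :
    ∀ P : List ((W.IdealSheafData → ℕ) × ℕ),
      measure 𝓔 (P.map (fun q => (peelExp S₀ q.1, q.2)) ++ [(singleExp S₀, c)]) +
          (P.map fun q => if 1 ≤ q.1 S₀ then q.2 else 0).sum = measure 𝓔 P + c := by
  intro P
  unfold measure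
  simp only [List.map_append, List.map_map, List.sum_append, List.map_cons, List.map_nil, List.sum_cons, List.sum_nil,
    add_zero, degOf_singleExp hS₀ hS₀t, mul_one, Function.comp_def]
  induction P with
  | nil => simp
  | cons q P ih =>
    simp only [List.map_cons, List.sum_cons]
    have hq := degOf_peelExp hS₀ hS₀t q.1
    by_cases h1 : 1 ≤ q.1 S₀
    · rw [if_pos h1] at hq ⊢; rw [hq]; ring_nf; omega
    · rw [if_neg h1] at hq ⊢; rw [add_zero] at hq; rw [hq]; omega

end HSepPeel

end Summit.ResolutionOfSingularities.ResolutionOfSingularities.Theorems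

end
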